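import Literature.Analysis.FluidPDE.WuSteadyLiouville2026
import Literature.Analysis.FluidPDE.SereginWangAnnularLiouvilleHolds
import HarnessLib

/-!
# CLAIM SKELETON — Wangzhe Wu, *The Global Weak-Lorentz Vorticity Endpoint in the Stationary
# Navier–Stokes Liouville Problem* (arXiv:2608.22471v1 [math.AP], 23 Aug 2026, 27 pp.)

D-0090 NS-CLAIMS sweep, claim **C177 `Wu2026`** (RULINGS v1.51, lead-1 g7, 2026-08-27T18:41:05Z:
LADDER-BEARING intake under DIRECTOR-NS g8 — rung 3, critical Liouville / Wu-type bridge; the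
row's CLAIMED cell is the printed theorem itself, NOT a Clay claim). Typist of record
`ns-claims-typist-10 g6`; CARD `run/shared/lean/pub/ns-claims/claims/Wu2026/CARD.md` (§1–§4
sealed blind before pp. 3–27 were opened, sha16 97857e2e4287e915).

TEXT OF RECORD: arXiv:2608.22471v1 (v1 only; single author as printed «Wangzhe Wu, School of
Mathematics and Statistics, Ningbo University»), PDF sha16 cc4808cea0a6b84a, 27 pp.; PDF page =
printed page = `ns-claims-census-1/tranche2-staging/Wu2026/pages/pNNN.txt`. Locators below are
`p.N l.a–b` = PDF page N, lines of that page file. p.27 carries a generative-AI-assistance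
declaration (recorded by the chair, no inference drawn).

WHAT THIS FILE IS. A typing of the paper's OWN proof chain of its Theorem 1.1 as named `Prop`s,
with the compositions PROVED. Nothing here asserts that any step holds; nothing is proved by
`sorry`/`axiom`. TYPING RULE of the ruling («cite, never restate»): the claimed statement is the
tree's existing rendering `Literature.Analysis.FluidPDE.Wu2026_thm11` (file
`Literature/Analysis/FluidPDE/WuSteadyLiouville2026.lean`, a NAMED FACT vendored as a hypothesis,
no `_holds`), and Corollary 1.2 is the tree's `Wu2026_cor12`, linked by the tree's PROVED
`Wu2026_cor12_of_thm11`. The skeleton therefore IMPORTS that file and sets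
`ClaimedTheorem := Wu2026_thm11`; the hypothesis bundle `IsWuFlow` below is definitionally the
antecedent of `Wu2026_thm11` (`claimedTheorem_iff`, proved by `Iff.rfl`-unfolding).

WHAT THIS IS NOT: not a claim about NS regularity or blow-up; not a claim about any author beyond
the typed locator. In particular this file does not endorse or refute the preprint.

## The printed chain (§1.5 «Outline of the proof», p.4 l.35 – p.5 l.21) and its typing

Setting (p.1 (1.1), p.2 Thm 1.1): `(v, p)` smooth on `ℝ³`, `−νΔv + (v·∇)v + ∇p = 0`, `div v = 0`
(the tree states the `ν`-family, `ν > 0`, equivalent to the printed `ν = 1` by `v ↦ ν⁻¹v`,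
`p ↦ ν⁻²p`; every display below is the printed `ν = 1` display with `ν` re-inserted where it
scales: `ν_j = ν R_j^{-1/3}` in (3.50), `ν|∇v|²` in (3.72)), `v → 0` at `∞`, `ω = curl v ∈ L^{9/5,∞}`.

* §2, Lemma 2.1 (p.5 l.30 – p.6 l.77) — endpoint Biot–Savart representation (2.2), weak bound
  `‖v‖_{L^{9/2,∞}} ≤ C‖ω‖_{L^{9/5,∞}}` (2.3) and FINITE DIRICHLET ENERGY `D(v) ≤ C‖ω‖³` (2.4) via
  Seregin–Wang 2020 Thm 1.1 (i) [15] (tree: `SereginWang2020_annular_liouville_holds`, PROVED, in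
  the Lebesgue instance `ℓ = q`; the paper uses `ℓ = ∞`, `q = 9/2`). ⟶ `Step_L21`.
* §3 preamble (p.7 l.12–29): `D < ∞` (3.2); `‖ω‖²_{L²} = D` (3.3) (whole-space div–curl identity
  [8]) ⟶ `Step_33`; «If D = 0 the conclusion is immediate» ⟶ `Step_D0`.
* §3.1 (p.7 l.30 – p.9 l.51): three-regime layer cake (3.4)–(3.6) ⟹ dyadic mass bound
  `Σ_{k ≤ N} a_k ≤ C₀(N+1)` (3.8) ⟶ `Step_38`; Lemma 3.1 (dyadic good-scale selection, p.8 l.54 –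
  p.9 l.45; ELEMENTARY, about nonnegative real sequences) ⟶ `Step_L31`; scales `R_j = 2^{n_j}` (3.16).
* §3.2 (p.9 l.52 – p.13 l.87): annular strong sub-endpoint bound (3.18) ⟶ `Step_318`; blow-down
  `V_j(y) = R_j^{2/3} v(R_j y)` (3.19) ⟶ `blowDown`; weak bounds (3.20)–(3.25), Rellich (3.26)–(3.28),
  Lemma 3.2 (stability of local weak-Lorentz bounds) (3.29)–(3.31), strong exterior bounds at the
  good scales (3.32)–(3.35).
* §3.3 (p.14 l.1 – p.17 l.45): canonical pressure `p = R_iR_k(v_iv_k)` (3.36) (a constant shift of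
  the given pressure), weak bound (3.41) ⟶ `Step_341`; rescaled pressure `P_j = R_j^{4/3}p(R_j y)`,
  `Q_j = P_j + |V_j|²/2` (3.38) ⟶ `blowDownP`, `bern`; compactness (3.45), (3.46)–(3.49).
* §3.4 (p.17 l.46 – p.19 l.108): Euler limit (3.51), Lamb form (3.52)–(3.53), local energy identity
  (3.54), `div(QV) = 0` on `ℝ³ ∖ {0}` (3.57), radial flux `F(r) = F` a.e. (3.58)–(3.59).
  The OUTPUT of §3.1–§3.4 — an «Euler blow-down tangent» (p.18 l.7) along good scales with the
  printed properties (3.9)/(3.32), (3.28), (3.45), (3.31)/(3.61), (3.35), (3.51), `div V = 0`,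
  (3.57) — is the structure `Tangent` below (fields = those printed properties, stated as weak /
  distributional identities against smooth compactly supported test functions and as
  distribution-function inequalities; no Lorentz-space or Sobolev-space API is needed), and its
  EXISTENCE is `Step_construct` (⟵ (3.8)-good scales, (3.18), (3.41)).
* §3.5, Proposition 3.3 (p.20 l.23–105): Sobolev Bernoulli companion law
  `div(β(Q)V) = 0` in `D'({|y| > 1})` for `β ∈ C¹`, `β'` bounded (3.60) ⟶ `Step_P33`.
* §3.6, Proposition 3.4 (p.21 l.1 – p.23 l.46): the renormalised fluxes `F_τ` (3.62)–(3.65) vanish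
  (3.66) and the ordinary flux vanishes, `∫_{S_r} QV·n dS = 0` for a.e. `r` (3.67) ⟶ `Step_P34`
  (typed on `r > 1`, the range consumed by (3.86)).
* §3.7 (p.23 l.47 – p.26 l.161): NS Bernoulli function `𝒬 = p + |v|²/2`, identity (3.72); annular
  current bounds (3.73)–(3.78); harmonic cutoff `Φ_R = min{1, R/|x|}` (3.79)–(3.80); the harmonic
  cutoff identity (3.82) `∫Φ_R|∇v|² + (1/2R)∫_{S_R}|v|² = −R∫_{|x|>R} 𝒬 v·x/|x|³` ⟶ `Step_382`
  (typed in the CONSUMED form `∫Φ_R ν|∇v|² ≤ −R∫…`: «In (3.83) the sphere term is used only through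
  its nonnegativity», Remark 3.5 p.26 l.162–171); passage to the tangent current (3.83)–(3.85) ⟶
  `Step_385`; coarea evaluation (3.86) `∫_{|y|>1} QV·n |y|^{-2} dy = F` ⟶ `Step_386`; dominated
  convergence (3.87) ⟶ `Step_387`; conclusion `D = 0`, hence `v ≡ 0` (p.26 l.160–161) ⟶ `Step_D0`.
* Composition ⟶ `claim_of_steps` (PROVED): exactly the proof of Theorem 1.1 on p.26 l.107–161
  assembled from the Steps, by cases on `D = 0`.

HAZARD NOTES (typist's, for the REF/refuters; no adjudication): (h1) every `Step_*` is a
universally quantified implication over flows satisfying `IsWuFlow` — none is an identification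
or a modelling assumption; (h2) `Step_L31`, `Step_33`, `Step_318`, `Step_386`, `Step_387`,
`Step_D0` are classical/elementary statements (TRUE-type candidates; `Step_L31` is pure
combinatorics of real sequences and is a candidate for an in-file proof in a later rev);
(h3) weak formulations: Lean's `∫` returns `0` on non-integrable integrands, so every weak identity
in `Tangent` is paired with the local-integrability field that makes it meaningful (`locInt`,
`sobolev.1`); (h4) the pressure of §3.3 ff. is the CANONICAL pressure `p − c` (3.36) — carried as
the field `Tangent.c` with (3.41) as `Tangent.weakP`; (h5) the tree's Seregin–Wang theorem is the
Lebesgue instance `ℓ = q ∈ (3, 9/2)`, which the paper's own (3.18) feeds equally well (p.6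
l.63–77 uses `ℓ = ∞`); recorded, not used — `Step_L21` is typed as printed.
-/

noncomputable section

open MeasureTheory Set Function Filter Topology
open scoped ENNReal NNReal RealInnerProductSpace

namespace Literature.Claims.NS.Wu2026

open Literature.Analysis.FluidPDE Literature.Analysis.FunctionSpaces

/-- Physical space `ℝ³`. [cite: Wu2026, §1 p.1 (setting ℝ³)] -/
abbrev E3 := EuclideanSpace ℝ (Fin 3)

/-! ## The claimed statements — BY CITATION of the tree's renderings (TYPING RULE) -/

/-- **Theorem 1.1** (p.2 l.30–37) «Let (v, p) be a smooth solution of (1.1) in R³ such that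
v(x) → 0 as |x| → ∞, and let ω = curl v. If ω ∈ L^{9/5,∞}(R³), (1.4) then v ≡ 0.» — typed AS the
tree's named fact `Literature.Analysis.FluidPDE.Wu2026_thm11` (`WuSteadyLiouville2026.lean`
l.115; the `ν`-family, `IsLerayProfile ν 0 U P` + `C^∞` + `Tendsto U (cocompact) (𝓝 0)` +
`MemWeakLp (curl U) (9/5) volume → U = 0`). [cite: Wu2026, Thm 1.1 p.2] -/
def ClaimedTheorem : Prop := Literature.Analysis.FluidPDE.Wu2026_thm11

/-- **Corollary 1.2** (p.2 l.42–56) «If E_ω := limsup_{|x|→∞} |x|^{5/3}|curl v(x)| < ∞, then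
v ≡ 0.» — typed AS the tree's `Literature.Analysis.FluidPDE.Wu2026_cor12` (l.132). [cite: Wu2026, Cor 1.2 p.2] -/
def ClaimedCor : Prop := Literature.Analysis.FluidPDE.Wu2026_cor12

/-- p.2 l.52–56 «Indeed, E_ω < ∞ gives |ω(x)| ≤ C|x|^{−5/3} outside a sufficiently large ball.
Together with smoothness on the remaining bounded set, this places ω in L^{9/5,∞}(R³).» — the
tree's PROVED `Wu2026_cor12_of_thm11`. [cite: Wu2026, Cor 1.2 proof p.2 l.52–56] -/
theorem claimedCor_of_claimedTheorem (h : ClaimedTheorem) : ClaimedCor :=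
  Wu2026_cor12_of_thm11 h

/-- The hypothesis bundle of Theorem 1.1 (p.2 l.30–36), field for field the antecedent of the
tree's `Wu2026_thm11`: smooth steady solution (`IsLerayProfile ν 0 v p`: `−νΔv + (v·∇)v + ∇p = 0`,
`div v = 0`, plus `C^∞`), `v → 0` at infinity, `curl v ∈ L^{9/5,∞}(ℝ³)` (1.4). [cite: Wu2026, Thm 1.1 hypotheses p.2 l.30–36] -/
structure IsWuFlow (ν : ℝ) (v : E3 → E3) (p : E3 → ℝ) : Prop where
  profile : IsLerayProfile ν 0 v p
  smooth_v : ContDiff ℝ (⊤ : ℕ∞) v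
  smooth_p : ContDiff ℝ (⊤ : ℕ∞) p
  decay : Tendsto v (cocompact E3) (𝓝 0)
  weakVort : MemWeakLp (curl v) ((9 : ℝ≥0∞) / 5) volume

/-- `ClaimedTheorem` unfolded: every `IsWuFlow` is trivial. [cite: Wu2026, Thm 1.1 p.2 l.30–37] -/
theorem claimedTheorem_iff :
    ClaimedTheorem ↔ ∀ ν : ℝ, 0 < ν → ∀ (v : E3 → E3) (p : E3 → ℝ), IsWuFlow ν v p → v = 0 := by
  refine ⟨fun h ν hν v p hf => h ν hν v p hf.profile hf.smooth_v hf.smooth_p hf.decay hf.weakVort,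
    fun h ν hν v p h1 h2 h3 h4 h5 => h ν hν v p ⟨h1, h2, h3, h4, h5⟩⟩

/-! ## Objects of the proof -/

/-- The Dirichlet energy `D(v) = ∫_{ℝ³} |∇v|² dx` (p.3 l.9–13; (2.4), (3.2)), in `ℝ≥0∞` as in the
tree's `SteadyLiouvilleCriteria.lean` (`frobeniusNormSq (fderiv ℝ v x) = |∇v(x)|²`). [cite: Wu2026, D(v) p.3 l.9–13, (3.2) p.7] -/
def dirichlet (v : E3 → E3) : ℝ≥0∞ :=
  ∫⁻ x, ENNReal.ofReal (frobeniusNormSq (fderiv ℝ v x))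

/-- The dyadic annulus `A_R = {R < |x| < 2R}` (p.5 l.58; (3.7) with `R = 2^k`). [cite: Wu2026, A_R p.5 l.58, (3.7) p.8] -/
def annulus (R : ℝ) : Set E3 := {x | R < ‖x‖ ∧ ‖x‖ < 2 * R}

/-- The dyadic vorticity masses `a_k = ∫_{A_{2^k}} |ω|^{9/5} dx`, `k ≥ 0` (3.7) (p.8 l.36–44). [cite: Wu2026, (3.7) p.8 l.36–44] -/
def dyMass (v : E3 → E3) (k : ℕ) : ℝ :=
  ∫ x in annulus ((2 : ℝ) ^ k), ‖curl v x‖ ^ ((9 : ℝ) / 5)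

/-- The far-field blow-down `V_R(y) = R^{2/3} v(Ry)` (1.2), (3.19) (p.2 l.5–9, p.10 l.48–54). [cite: Wu2026, (1.2) p.2, (3.19) p.10] -/
def blowDown (R : ℝ) (v : E3 → E3) (y : E3) : E3 := (R ^ ((2 : ℝ) / 3)) • v (R • y)

/-- The rescaled pressure `P_R(y) = R^{4/3} p(Ry)` (3.38) (p.14 l.52–61). [cite: Wu2026, (3.38) p.14 l.52–61] -/
def blowDownP (R : ℝ) (p : E3 → ℝ) (y : E3) : ℝ := R ^ ((4 : ℝ) / 3) * p (R • y)

/-- The Bernoulli function `Q = P + |V|²/2` of a pair `(V, P)` (3.38) / the NS Bernoulli function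
`𝒬 = p + |v|²/2` (p.23 l.53–55). [cite: Wu2026, (3.38) p.14; 𝒬 p.23 l.53–55] -/
def bern (V : E3 → E3) (P : E3 → ℝ) (y : E3) : ℝ := P y + ‖V y‖ ^ 2 / 2

/-- The harmonic cutoff `Φ_R(x) = min{1, R/|x|}` (3.79), `Φ_R(0) = 1` (p.24 l.91–98). [cite: Wu2026, (3.79) p.24 l.91–98] -/
def PhiR (R : ℝ) (x : E3) : ℝ := if ‖x‖ ≤ R then 1 else R / ‖x‖

/-- The cutoff Dirichlet energy `∫ Φ_R ν|∇v|² dx` — the first term of (3.82) (with the viscosity of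
the `ν`-family; printed `ν = 1`). [cite: Wu2026, (3.82) p.25 (first term)] -/
def cutoffEnergy (ν R : ℝ) (v : E3 → E3) : ℝ :=
  ∫ x, PhiR R x * (ν * frobeniusNormSq (fderiv ℝ v x))

/-- The physical energy current of (3.82), right-hand side: `−R ∫_{|x|>R} 𝒬(x) v(x)·x |x|^{-3} dx`
with `𝒬 = q + |v|²/2` for a pressure representative `q` (p.25 l.107–124). [cite: Wu2026, (3.82) p.25 l.107–124] -/
def current382 (R : ℝ) (v : E3 → E3) (q : E3 → ℝ) : ℝ :=
  -(R * ∫ x in {x : E3 | R < ‖x‖}, bern v q x * ⟪v x, x⟫ / ‖x‖ ^ 3)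

/-- The tangent current `∫_{|y|>1} Q(y) V(y)·n(y) |y|^{-2} dy = ∫_{|y|>1} Q V·y |y|^{-3} dy` —
the right-hand side of (3.83) without its sign, evaluated in (3.86) (p.25 l.127–145, p.26 l.85–106). [cite: Wu2026, (3.83)/(3.86) p.25–26] -/
def tangentCurrent (V : E3 → E3) (P : E3 → ℝ) : ℝ :=
  ∫ y in {y : E3 | 1 < ‖y‖}, bern V P y * ⟪V y, y⟫ / ‖y‖ ^ 3

/-- Smooth compactly supported scalar test functions supported inside an open set `S`
(`C_c^∞(S)`). [cite: Wu2026, test functions, (3.51)/(3.57)/(3.60) p.17–21] -/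
def IsTest (S : Set E3) (φ : E3 → ℝ) : Prop :=
  ContDiff ℝ (⊤ : ℕ∞) φ ∧ HasCompactSupport φ ∧ tsupport φ ⊆ S

/-- Smooth compactly supported vector test fields supported inside `S` (`C_c^∞(S; ℝ³)`). [cite: Wu2026, test fields, (3.50)–(3.51) p.17–18] -/
def IsTestVec (S : Set E3) (Φ : E3 → E3) : Prop :=
  ContDiff ℝ (⊤ : ℕ∞) Φ ∧ HasCompactSupport Φ ∧ tsupport Φ ⊆ S

/-- Smooth compactly supported radial profiles `η ∈ C_c^∞(I)` on an interval `I ⊆ ℝ`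
(p.19 l.95–104, p.21 l.81–89). [cite: Wu2026, radial profiles η, p.19 l.95–104, p.21 l.81–89] -/
def IsTestRad (I : Set ℝ) (η : ℝ → ℝ) : Prop :=
  ContDiff ℝ (⊤ : ℕ∞) η ∧ HasCompactSupport η ∧ tsupport η ⊆ I

/-- `div W = 0` in `D'(S)`: `∫ W·∇φ = 0` for every `φ ∈ C_c^∞(S)` (the weak form used in (3.51),
(3.57), (3.60), (3.64)). [cite: Wu2026, weak form of (3.51)/(3.57)/(3.60)/(3.64)] -/
def WeakDivFreeOn (S : Set E3) (W : E3 → E3) : Prop :=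
  ∀ φ : E3 → ℝ, IsTest S φ → ∫ y, ⟪W y, gradient φ y⟫ = 0

/-- ZERO RADIAL FLUX of the current `Q V` through almost every sphere `S_r`, `r ∈ I`:
`∫_{S_r} Q V·n dS = 0` for a.e. `r ∈ I` — in the weak form obtained by coarea, `∫ η(|y|) Q V·n /1 dy
= ∫_I η(r) F(r) dr = 0` for every `η ∈ C_c^∞(I)` (p.19 l.95–107, p.23 l.37–46; (3.67)). [cite: Wu2026, (3.58)–(3.59) p.19, (3.67) p.22–23] -/
def ZeroRadialFlux (I : Set ℝ) (V : E3 → E3) (Q : E3 → ℝ) : Prop :=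
  ∀ η : ℝ → ℝ, IsTestRad I η → ∫ y, η ‖y‖ * (Q y * ⟪V y, y⟫ / ‖y‖) = 0

/-- The punctured space `ℝ³ ∖ {0}` and the exterior region `{|y| > 1}`. [cite: Wu2026, ℝ³ ∖ {0}, p.11 l.44–50, (3.51)] -/
def punctured : Set E3 := {y | y ≠ 0}

/-- The exterior region `{|y| > 1}` (p.13, p.18 l.8, p.20). [cite: Wu2026, {|y| > 1}, p.13 l.22, (3.35), (3.60)] -/
def exterior : Set E3 := {y | 1 < ‖y‖}

/-- **The Euler blow-down tangent along good scales** (p.18 l.7 «We call any subsequential limit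
(V, P) obtained in this way an Euler blow-down tangent») — the OUTPUT of §3.1–§3.4 for a flow
`(v, p)` with `0 < D < ∞`, recorded with exactly the printed properties that §3.5–§3.7 consume:
* `q0`, `hq0`: the exponent of (3.26) (p.11 l.13–28), `3 < q₀ < 9/2`;
* `n`, `n_tendsto`, `good`: the good dyadic scales of Lemma 3.1, `R_j = 2^{n_j} → ∞` (3.16), with
  the one-sided strong vorticity bounds (3.9) = (3.32) `a_{n_j+m} ≤ B_m` for `j ≥ max{1,m}`
  (p.9 l.46–51, p.13 l.6–11);
* `c`, `weakP`: the canonical pressure `p − c = R_iR_k(v_iv_k)` (3.36) (p.14 l.29–43: «the original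
  pressure and p_can differ only by one constant») with its weak bound (3.41) `p − c ∈ L^{9/4,∞}`,
  `𝒬 ∈ L^{9/4,∞}` (p.15 l.1–7);
* `V`, `P` and `locInt`: the limit pair, locally `L^{q₀} × L^{q₀/2}` on `ℝ³ ∖ {0}`;
* `convV` (3.28) (p.11 l.44–50) and `convP` (3.45) (p.16 l.21–27): strong local convergence of
  `V_j = blowDown R_j v`, `P_j = blowDownP R_j (p − c)` on compact subsets of `ℝ³ ∖ {0}`;
* `weakBd` (3.61) (p.21 l.5–24): the inherited scale-invariant weak bounds on every annulus `A_R`,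
  `‖V‖_{L^{9/2,∞}(A_R)} + ‖Q‖_{L^{9/4,∞}(A_R)} + ‖QV‖_{L^{3/2,∞}(A_R)} ≤ C` uniformly in `R > 0`,
  as distribution-function inequalities;
* `sobolev` (3.35) (p.13 l.70–83): `V ∈ W^{1,9/5}_loc({|y| > 1}) ∩ L^{9/2}_loc({|y| > 1})`, as a weak
  gradient `G` (columns `G y k = ∂_k V`) with `|G|^{9/5}`, `|V|^{9/2}` locally integrable there;
* `euler` (3.51) (p.18 l.1–6): `div(V ⊗ V) + ∇P = 0` in `D'(ℝ³ ∖ {0}; ℝ³)`; `divFree`: `div V = 0`;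
* `bernLaw` (3.57) (p.19 l.71–76): `div(QV) = 0` in `D'(ℝ³ ∖ {0})`, `Q = P + |V|²/2`. [cite: Wu2026, Euler blow-down tangent p.18 l.7; (3.9),(3.28),(3.35),(3.41),(3.45),(3.51),(3.57),(3.61)] -/
structure Tangent (ν : ℝ) (v : E3 → E3) (p : E3 → ℝ) where
  /-- (3.26) -/
  q0 : ℝ
  hq0 : 3 < q0 ∧ q0 < 9 / 2
  /-- good dyadic exponents `n_j` of Lemma 3.1, `R_j = 2^{n_j}` (3.16) -/
  n : ℕ → ℕ
  n_tendsto : Tendsto n atTop atTop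
  /-- (3.9) = (3.32): `a_{n_j + m} ≤ B_m` whenever `j ≥ max{1, m}` -/
  good : ∀ m : ℕ, ∃ B : ℝ, ∀ j : ℕ, max 1 m ≤ j → dyMass v (n j + m) ≤ B
  /-- the canonical pressure constant of (3.36) -/
  c : ℝ
  /-- (3.41): `p − c ∈ L^{9/4,∞}(ℝ³)` and `𝒬 = (p − c) + |v|²/2 ∈ L^{9/4,∞}(ℝ³)` -/
  weakP : MemWeakLp (fun x => p x - c) ((9 : ℝ≥0∞) / 4) volume ∧
    MemWeakLp (bern v (fun x => p x - c)) ((9 : ℝ≥0∞) / 4) volume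
  /-- the Euler blow-down tangent `(V, P)` -/
  V : E3 → E3
  P : E3 → ℝ
  locInt : AEStronglyMeasurable V volume ∧ AEStronglyMeasurable P volume ∧
    ∀ K : Set E3, IsCompact K → K ⊆ punctured →
      IntegrableOn (fun y => ‖V y‖ ^ q0) K ∧ IntegrableOn (fun y => |P y| ^ (q0 / 2)) K
  /-- (3.28): `V_j → V` strongly in `L^{q₀}_loc(ℝ³ ∖ {0})` -/
  convV : ∀ K : Set E3, IsCompact K → K ⊆ punctured →
    Tendsto (fun j => ∫ y in K, ‖blowDown ((2 : ℝ) ^ n j) v y - V y‖ ^ q0) atTop (𝓝 0)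
  /-- (3.45): `P_j → P` strongly in `L^{q₀/2}_loc(ℝ³ ∖ {0})` (with the canonical pressure) -/
  convP : ∀ K : Set E3, IsCompact K → K ⊆ punctured →
    Tendsto (fun j => ∫ y in K, |blowDownP ((2 : ℝ) ^ n j) (fun x => p x - c) y - P y| ^ (q0 / 2))
      atTop (𝓝 0)
  /-- (3.61): uniform weak bounds on every annulus `A_R`, `R > 0` -/
  weakBd : ∃ C : ℝ, 0 ≤ C ∧ ∀ R : ℝ, 0 < R → ∀ t : ℝ, 0 < t →
    (volume {y | y ∈ annulus R ∧ t < ‖V y‖}).toReal ≤ C * t ^ (-((9 : ℝ) / 2)) ∧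
    (volume {y | y ∈ annulus R ∧ t < |bern V P y|}).toReal ≤ C * t ^ (-((9 : ℝ) / 4)) ∧
    (volume {y | y ∈ annulus R ∧ t < |bern V P y| * ‖V y‖}).toReal ≤ C * t ^ (-((3 : ℝ) / 2))
  /-- (3.35): `∇V, curl V ∈ L^{9/5}_loc({|y| > 1})`, `V ∈ L^{9/2}_loc({|y| > 1})`, via a weak
  gradient `G` -/
  sobolev : ∃ G : E3 → Fin 3 → E3,
    (∀ K : Set E3, IsCompact K → K ⊆ exterior →
      IntegrableOn (fun y => (∑ k, ‖G y k‖ ^ 2) ^ ((9 : ℝ) / 10)) K ∧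
      IntegrableOn (fun y => ‖V y‖ ^ ((9 : ℝ) / 2)) K) ∧
    ∀ φ : E3 → ℝ, IsTest exterior φ → ∀ k : Fin 3,
      ∫ y, (fderiv ℝ φ y (EuclideanSpace.single k 1)) • V y = -∫ y, φ y • G y k
  /-- (3.51): `div(V ⊗ V) + ∇P = 0` in `D'(ℝ³ ∖ {0})`, i.e. `∫ (V⊗V):∇Φ + P div Φ = 0` -/
  euler : ∀ Φ : E3 → E3, IsTestVec punctured Φ →
    ∫ y, (⟪V y, fderiv ℝ Φ y (V y)⟫ + P y * VectorCalculus.divergence Φ y) = 0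
  /-- `div V = 0` in `D'(ℝ³ ∖ {0})` (p.18 l.1) -/
  divFree : WeakDivFreeOn punctured V
  /-- (3.57): `div(QV) = 0` in `D'(ℝ³ ∖ {0})` -/
  bernLaw : WeakDivFreeOn punctured (fun y => bern V P y • V y)

/-- The good scales `R_j = 2^{n_j}` (3.16). [cite: Wu2026, (3.16) p.9 l.46–47] -/
def Tangent.R {ν : ℝ} {v : E3 → E3} {p : E3 → ℝ} (T : Tangent ν v p) (j : ℕ) : ℝ :=
  (2 : ℝ) ^ T.n j

/-- The tangent Bernoulli function `Q = P + |V|²/2` (3.38)/(p.20 l.2). [cite: Wu2026, (3.38) p.14, p.20 l.2] -/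
def Tangent.Q {ν : ℝ} {v : E3 → E3} {p : E3 → ℝ} (T : Tangent ν v p) : E3 → ℝ := bern T.V T.P

/-- `R_j → ∞` (p.9 l.42 «n_j → ∞», (3.16)). [cite: Wu2026, (3.16), p.9 l.42] -/
theorem Tangent.R_tendsto {ν : ℝ} {v : E3 → E3} {p : E3 → ℝ} (T : Tangent ν v p) :
    Tendsto T.R atTop atTop :=
  (tendsto_pow_atTop_atTop_of_one_lt (by norm_num : (1 : ℝ) < 2)).comp T.n_tendsto

/-! ## The steps (each a named `Prop`; docstring = locator + «quote») -/

/-- **Lemma 2.1** (p.5 l.30–56; proof p.5 l.57 – p.6 l.77) «Let (v, p) be a smooth solution of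
(1.1) such that v(x) → 0 as |x| → ∞, and let ω = curl v. If ω ∈ L^{9/5,∞}(R³), (2.1) then
v(x) = (1/4π)∫ ω(y) × (x − y)/|x − y|³ dy, (2.2) … Moreover, ‖v‖_{L^{9/2,∞}(R³)} ≤ C‖ω‖_{L^{9/5,∞}(R³)},
(2.3) and D(v) := ∫|∇v|² dx ≤ C‖ω‖³_{L^{9/5,∞}(R³)}. (2.4)» — typed through its two consumed
conclusions: `v ∈ L^{9/2,∞}` and `D(v) < ∞` ((3.2), (3.17)). Printed route: Biot–Savart +
Lorentz–HLS (2.8), Liouville for the harmonic remainder (p.6 l.49–62), then Seregin–Wang 2020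
Thm 1.1 (i) with `q = 9/2, ℓ = ∞, γ = 2/3` (p.6 l.63–77; tree: `SereginWang2020_annular_liouville_holds`,
Lebesgue instance). [cite: Wu2026, Lemma 2.1 p.5] -/
def Step_L21 : Prop :=
  ∀ ν : ℝ, 0 < ν → ∀ (v : E3 → E3) (p : E3 → ℝ), IsWuFlow ν v p →
    MemWeakLp v ((9 : ℝ≥0∞) / 2) volume ∧ dirichlet v < ∞

/-- **(3.3)** (p.7 l.20–26) «Since v is divergence-free and ∇v ∈ L², the standard whole-space
div–curl identity [8] gives ‖ω‖²_{L²(R³)} = D.» [cite: Wu2026, (3.3) p.7] -/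
def Step_33 : Prop :=
  ∀ ν : ℝ, 0 < ν → ∀ (v : E3 → E3) (p : E3 → ℝ), IsWuFlow ν v p → dirichlet v < ∞ →
    ∫⁻ x, ENNReal.ofReal (‖curl v x‖ ^ 2) = dirichlet v

/-- **(3.6) ⟹ (3.8)** (p.7 l.30 – p.8 l.49) «µ_E(λ) ≤ min{|E|, M^{9/5}λ^{−9/5}, Dλ^{−2}} (3.4) …
∫_E |ω|^{9/5} dx ≤ C_{M,D}(1 + log(2 + |E|)) (3.6). In particular, if A_{2^k} := {2^k < |x| < 2^{k+1}},
a_k := ∫_{A_{2^k}} |ω|^{9/5} dx, k ≥ 0, (3.7) then (3.6), applied to B_{2^{N+1}} ∖ B_1, implies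
Σ_{k=0}^{N} a_k ≤ C₀(N + 1), N ≥ 0. (3.8)» [cite: Wu2026, (3.4)–(3.8) p.7–8] -/
def Step_38 : Prop :=
  ∀ ν : ℝ, 0 < ν → ∀ (v : E3 → E3) (p : E3 → ℝ), IsWuFlow ν v p → dirichlet v < ∞ →
    ∫⁻ x, ENNReal.ofReal (‖curl v x‖ ^ 2) = dirichlet v →
    ∃ C0 : ℝ, ∀ N : ℕ, ∑ k ∈ Finset.range (N + 1), dyMass v k ≤ C0 * (N + 1)

/-- **Lemma 3.1 (Dyadic good-scale selection)** (p.8 l.54–57; proof p.8 l.58 – p.9 l.45) «If a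
nonnegative sequence satisfies (3.8), then there are integers n_j → ∞, indexed by j ≥ 1, and finite
constants B_m, indexed by m ≥ 0, such that a_{n_j+m} ≤ B_m whenever m ≥ 0 and j ≥ max{1, m}. (3.9)
In fact, one may take B_m = K₀(m + 1)², where K₀ = max{1, 16C₀}.» ELEMENTARY (real sequences). [cite: Wu2026, Lemma 3.1 p.8] -/
def Step_L31 : Prop :=
  ∀ a : ℕ → ℝ, (∀ k, 0 ≤ a k) →
    (∃ C0 : ℝ, ∀ N : ℕ, ∑ k ∈ Finset.range (N + 1), a k ≤ C0 * (N + 1)) →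
    ∃ n : ℕ → ℕ, Tendsto n atTop atTop ∧
      ∀ m : ℕ, ∃ B : ℝ, ∀ j : ℕ, max 1 m ≤ j → a (n j + m) ≤ B

/-- **(3.18)** (p.9 l.62 – p.10 l.47) «‖v‖_{L^q(A_R)} ≤ C_q M R^{−2/3+3/q}, 1 < q < 9/2, R > 0.
(3.18)» — from the weak bound (3.17) by the layer-cake formula split at `λ_E`. [cite: Wu2026, (3.18) p.10] -/
def Step_318 : Prop :=
  ∀ ν : ℝ, 0 < ν → ∀ (v : E3 → E3) (p : E3 → ℝ), IsWuFlow ν v p →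
    MemWeakLp v ((9 : ℝ≥0∞) / 2) volume →
    ∀ q : ℝ, 1 < q → q < 9 / 2 → ∃ C : ℝ, ∀ R : ℝ, 0 < R →
      IntegrableOn (fun x => ‖v x‖ ^ q) (annulus R) ∧
      (∫ x in annulus R, ‖v x‖ ^ q) ^ (1 / q) ≤ C * R ^ (-(2 : ℝ) / 3 + 3 / q)

/-- **(3.36) + (3.41)** (p.14 l.6–45, p.15 l.1–7) «By the homogeneous Sobolev theorem and (3.2),
there is a constant vector c ∈ R³ such that ‖v − c‖_{L⁶} ≤ C‖∇v‖_{L²}. The condition v(x) → 0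
forces c = 0 … Define the canonical pressure by p_can := R_iR_k(v_iv_k). … ∇p = ∇p_can in
distributions. Thus the original pressure and p_can differ only by one constant. After changing the
original pressure by this constant, we write from now on p = p_can = R_iR_k(v_iv_k) ∈ L³(R³), (3.36)
… ‖p‖_{L^{9/4,∞}(R³)} + ‖p + |v|²/2‖_{L^{9/4,∞}(R³)} ≤ C. (3.41)» [cite: Wu2026, (3.36)/(3.41) p.14–15] -/
def Step_341 : Prop :=
  ∀ ν : ℝ, 0 < ν → ∀ (v : E3 → E3) (p : E3 → ℝ), IsWuFlow ν v p → dirichlet v < ∞ →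
    MemWeakLp v ((9 : ℝ≥0∞) / 2) volume →
    ∃ c : ℝ, MemWeakLp (fun x => p x - c) ((9 : ℝ≥0∞) / 4) volume ∧
      MemWeakLp (bern v (fun x => p x - c)) ((9 : ℝ≥0∞) / 4) volume

/-- **Construction of the Euler blow-down tangent, §3.2–§3.4** ((3.16), (3.19)–(3.35), (3.38)–(3.59);
p.9 l.46 – p.19 l.108): given the good scales of Lemma 3.1 for the dyadic masses (3.8), the annular
bound (3.18) and the canonical pressure (3.36)/(3.41), «Applying this argument on a nested exhaustion
by bounded Lipschitz domains and taking a diagonal subsequence, we find a vector field V such that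
V_j → V strongly in L^{q₀}_loc(R³ ∖ {0}). (3.28)» … «(3.31)» … «(3.35)» … «P_j → P, Q_j → Q strongly
in L^{q₀/2}_loc(R³ ∖ {0}). (3.45)» … «We obtain div(V ⊗ V) + ∇P = 0, div V = 0 in D′(R³ ∖ {0}).
(3.51)» … «div(QV) = 0 in D′(R³ ∖ {0}). (3.57)» … (3.61): the structure `Tangent` is inhabited, with
the given scales and pressure constant (after passing to the subsequences of p.11 l.44–50, p.16
l.3–6 — a subsequence of good scales is again good). [cite: Wu2026, §3.2–§3.4 p.9–19] -/
def Step_construct : Prop :=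
  ∀ ν : ℝ, 0 < ν → ∀ (v : E3 → E3) (p : E3 → ℝ), IsWuFlow ν v p → dirichlet v < ∞ →
    0 < dirichlet v → MemWeakLp v ((9 : ℝ≥0∞) / 2) volume →
    (∀ q : ℝ, 1 < q → q < 9 / 2 → ∃ C : ℝ, ∀ R : ℝ, 0 < R →
      IntegrableOn (fun x => ‖v x‖ ^ q) (annulus R) ∧
      (∫ x in annulus R, ‖v x‖ ^ q) ^ (1 / q) ≤ C * R ^ (-(2 : ℝ) / 3 + 3 / q)) →
    ∀ c : ℝ, MemWeakLp (fun x => p x - c) ((9 : ℝ≥0∞) / 4) volume →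
      MemWeakLp (bern v (fun x => p x - c)) ((9 : ℝ≥0∞) / 4) volume →
    ∀ n : ℕ → ℕ, Tendsto n atTop atTop →
      (∀ m : ℕ, ∃ B : ℝ, ∀ j : ℕ, max 1 m ≤ j → dyMass v (n j + m) ≤ B) →
    ∃ T : Tangent ν v p, T.c = c

/-- **Proposition 3.3 (Sobolev Bernoulli companion law)** (p.20 l.23–32; proof l.33–105) «For
every β ∈ C¹(R) with ‖β′‖_∞ < ∞, the Euler tangent satisfies div(β(Q)V) = 0 in D′({|y| > 1}).
(3.60)» Printed route: (3.53) `Q ∈ W^{1,9/7}(U) ∩ L^{9/4}(U)`, `V ∈ W^{1,9/5}(U) ∩ L^{9/2}(U)`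
(from (3.35) = `Tangent.sobolev`, (3.47), Lamb's form (3.52) `∇Q = V × curl V` from (3.51));
Sobolev chain and product rules [1]; `β′(Q)V·∇Q = β′(Q)V·(V × curl V) = 0` a.e. [cite: Wu2026, Prop 3.3 p.20] -/
def Step_P33 : Prop :=
  ∀ ν : ℝ, 0 < ν → ∀ (v : E3 → E3) (p : E3 → ℝ), IsWuFlow ν v p → 0 < dirichlet v →
    ∀ T : Tangent ν v p, ∀ β : ℝ → ℝ, ContDiff ℝ 1 β → (∃ L : ℝ, ∀ z, ‖deriv β z‖ ≤ L) →
      WeakDivFreeOn exterior (fun y => β (T.Q y) • T.V y)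

/-- **Proposition 3.4 (Vanishing of the renormalized and ordinary fluxes)** (p.22 l.3–8; proof
p.22 l.9 – p.23 l.46) «For every τ > 0, F_τ = 0. (3.66) Moreover, ∫_{S_r} QV·n dS = 0 for almost
every r > 0. (3.67)» — from the companion laws (3.60)/(3.64) for the truncations
`Ψ_τ(z) = z(1 − e^{−z²/τ})` (3.62)–(3.63), radial averaging (3.68) and the inherited weak bounds
(3.61) = `Tangent.weakBd` split at `|Q| = R^{−1}` (3.69)–(3.71), then spherewise dominated
convergence (p.23 l.20–46). Typed on the radii `r > 1` (the range where (3.64) holds and the only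
range consumed, in (3.86)); the extension to a.e. `r > 0` via (3.59) is recorded, not typed. [cite: Wu2026, Prop 3.4 p.22] -/
def Step_P34 : Prop :=
  ∀ ν : ℝ, 0 < ν → ∀ (v : E3 → E3) (p : E3 → ℝ), IsWuFlow ν v p → 0 < dirichlet v →
    ∀ T : Tangent ν v p,
      (∀ β : ℝ → ℝ, ContDiff ℝ 1 β → (∃ L : ℝ, ∀ z, ‖deriv β z‖ ≤ L) →
        WeakDivFreeOn exterior (fun y => β (T.Q y) • T.V y)) →
      ZeroRadialFlux (Ioi 1) T.V T.Q

/-- **The harmonic cutoff identity (3.82)** (p.23 l.53 – p.25 l.126) «The scalar product of (1.1)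
with v gives −∆(|v|²/2) + |∇v|² + div(𝒬v) = 0. (3.72)» … «R∫_{|x|>R} |𝒬v|/|x|² dx ≤ … < ∞. (3.74)
Thus the physical current integral used below is absolutely convergent.» … «Letting L → ∞ in (3.81)
proves ∫ Φ_R|∇v|² dx + (1/2R)∫_{S_R} |v|² dS = −R ∫_{|x|>R} 𝒬(x)v(x)·x/|x|³ dx. (3.82) The favorable
sign of the sphere term is a direct consequence of the negative surface measure in (3.80).» TYPED IN
THE CONSUMED FORM (Remark 3.5 p.26 l.162–171 «In (3.83) the sphere term is used only through its
nonnegativity»): `∫ Φ_R ν|∇v|² ≤ −R∫_{|x|>R} 𝒬 v·x/|x|³`, with `𝒬` built on the canonical pressure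
`p − c` of (3.36) (the identity (3.72) is insensitive to the constant; the convergence (3.73)–(3.74)
uses (3.42) for `p − c`). [cite: Wu2026, (3.72)–(3.82) p.23–25] -/
def Step_382 : Prop :=
  ∀ ν : ℝ, 0 < ν → ∀ (v : E3 → E3) (p : E3 → ℝ), IsWuFlow ν v p → dirichlet v < ∞ →
    ∀ c : ℝ, MemWeakLp (fun x => p x - c) ((9 : ℝ≥0∞) / 4) volume →
      ∀ R : ℝ, 0 < R →
        IntegrableOn (fun x => bern v (fun x => p x - c) x * ⟪v x, x⟫ / ‖x‖ ^ 3)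
          {x : E3 | R < ‖x‖} ∧
        cutoffEnergy ν R v ≤ current382 R v (fun x => p x - c)

/-- **Passage to the tangent current, (3.83)–(3.85)** (p.25 l.127 – p.26 l.84) «At R = R_j, (3.82)
becomes ∫ Φ_{R_j}|∇v|² dx + (1/2R_j)∫_{S_{R_j}}|v|² dS = −∫_{|y|>1} Q_j(y)V_j(y)·n(y)/|y|² dy.
(3.83)» … «Fatou's lemma and (3.78) give ∫_{|y|>L} |QV|/|y|² dy ≤ … ≤ C/L, L ≥ 1. (3.84)» …
«First letting j → ∞ and then L → ∞ proves lim_{j→∞} ∫_{|y|>1} Q_jV_j·n/|y|² dy =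
∫_{|y|>1} QV·n/|y|² dy. (3.85) The preceding tail estimates also show that the limit integral is
absolutely convergent.» — typed: along the tangent's scales the physical current (3.82) (which
EQUALS the rescaled current by the explicit scaling p.25 l.146 – p.26 l.5) converges to
`−tangentCurrent`, and the limit integrand is integrable on `{|y| > 1}`. [cite: Wu2026, (3.83)–(3.85) p.25–26] -/
def Step_385 : Prop :=
  ∀ ν : ℝ, 0 < ν → ∀ (v : E3 → E3) (p : E3 → ℝ), IsWuFlow ν v p → 0 < dirichlet v →
    ∀ T : Tangent ν v p,
      IntegrableOn (fun y => T.Q y * ⟪T.V y, y⟫ / ‖y‖ ^ 3) exterior ∧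
      Tendsto (fun j => current382 (T.R j) v (fun x => p x - T.c)) atTop
        (𝓝 (-tangentCurrent T.V T.P))

/-- **(3.86)** (p.26 l.85–106) «The coarea formula and (3.59) therefore give
∫_{|y|>1} QV·n/|y|² dy = ∫_1^∞ r^{−2} ∫_{S_r} QV·n dS dr = F ∫_1^∞ dr/r² = F. (3.86)» with
«By Theorem 3.4, F = 0»: zero radial flux on `(1, ∞)` and absolute convergence force the tangent
current to vanish (coarea / polar coordinates). [cite: Wu2026, (3.86) p.26] -/
def Step_386 : Prop :=
  ∀ (V : E3 → E3) (Q P : E3 → ℝ), Q = bern V P →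
    ZeroRadialFlux (Ioi 1) V Q →
    IntegrableOn (fun y => Q y * ⟪V y, y⟫ / ‖y‖ ^ 3) exterior →
    tangentCurrent V P = 0

/-- **(3.87)** (p.26 l.120–138) «Since R_j → ∞, 0 ≤ Φ_{R_j}(x) ≤ 1, Φ_{R_j}(x) → 1 for every
x ∈ R³. Because |∇v|² ∈ L¹(R³), dominated convergence gives ∫ Φ_{R_j}|∇v|² dx → ∫ |∇v|² dx (3.87)»
(with the viscosity factor of the `ν`-family). [cite: Wu2026, (3.87) p.26] -/
def Step_387 : Prop :=
  ∀ ν : ℝ, 0 < ν → ∀ (v : E3 → E3) (p : E3 → ℝ), IsWuFlow ν v p → dirichlet v < ∞ →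
    ∀ R : ℕ → ℝ, Tendsto R atTop atTop →
      Tendsto (fun j => cutoffEnergy ν (R j) v) atTop (𝓝 (ν * (dirichlet v).toReal))

/-- **`D = 0 ⟹ v ≡ 0`** (p.7 l.27 «If D = 0 the conclusion is immediate»; p.26 l.160–161 «Hence
∇v = 0 almost everywhere; smoothness makes v constant, and the zero far-field condition gives
v ≡ 0.») [cite: Wu2026, p.26 l.160–161] -/
def Step_D0 : Prop :=
  ∀ ν : ℝ, 0 < ν → ∀ (v : E3 → E3) (p : E3 → ℝ), IsWuFlow ν v p → dirichlet v = 0 → v = 0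

/-! ## Compositions (PROVED) -/

/-- The cutoff energy is nonnegative (`Φ_R ≥ 0`, `|∇v|² ≥ 0`; p.26 l.139 «Both terms on the left
of (3.83) are nonnegative»). [cite: Wu2026, p.26 l.139] -/
theorem cutoffEnergy_nonneg {ν : ℝ} (hν : 0 ≤ ν) (R : ℝ) (hR : 0 ≤ R) (v : E3 → E3) :
    0 ≤ cutoffEnergy ν R v := by
  unfold cutoffEnergy
  refine integral_nonneg fun x => ?_
  have hΦ : 0 ≤ PhiR R x := by
    unfold PhiR
    split_ifs
    · exact zero_le_one
    · exact div_nonneg hR (norm_nonneg _)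
  have hF : 0 ≤ frobeniusNormSq (fderiv ℝ v x) := by
    unfold frobeniusNormSq
    exact Finset.sum_nonneg fun i _ => sq_nonneg _
  exact mul_nonneg hΦ (mul_nonneg hν hF)

/-- **Composition = the proof of Theorem 1.1 (p.7 l.12–29 and p.26 l.107–161), assembled from the
printed steps.** Given a flow: `D < ∞` (Lemma 2.1); if `D = 0`, done (`Step_D0`); else the good
scales (3.8) + Lemma 3.1, the annular bound (3.18) and the canonical pressure (3.41) produce an
Euler blow-down tangent (`Step_construct`); its companion laws (Prop 3.3) kill the radial flux
(Prop 3.4), so the tangent current vanishes ((3.86)); the harmonic cutoff identity (3.82) bounds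
`∫Φ_{R_j} ν|∇v|²` by the physical current, which tends to minus the tangent current `= 0` ((3.85)),
while `∫Φ_{R_j} ν|∇v|² → νD` ((3.87)); hence `νD ≤ 0`, `D = 0`, contradiction — so `v ≡ 0`. [cite: Wu2026, proof of Thm 1.1, p.7 l.12–29 + p.26 l.107–161] -/
theorem claim_of_steps (h21 : Step_L21) (h33 : Step_33) (h38 : Step_38) (hL31 : Step_L31)
    (h318 : Step_318) (h341 : Step_341) (hcon : Step_construct) (hP33 : Step_P33)
    (hP34 : Step_P34) (h382 : Step_382) (h385 : Step_385) (h386 : Step_386) (h387 : Step_387)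
    (hD0 : Step_D0) : ClaimedTheorem := by
  rw [claimedTheorem_iff]
  intro ν hν v p hf
  obtain ⟨hweak, hD⟩ := h21 ν hν v p hf
  by_cases h0 : dirichlet v = 0
  · exact hD0 ν hν v p hf h0
  have hDpos : 0 < dirichlet v := pos_iff_ne_zero.mpr h0
  -- (3.8) and Lemma 3.1 (p.8): good dyadic scales `n_j`
  obtain ⟨C0, hC0⟩ := h38 ν hν v p hf hD (h33 ν hν v p hf hD)
  have ha : ∀ k, 0 ≤ dyMass v k := fun k =>
    integral_nonneg fun x => Real.rpow_nonneg (norm_nonneg _) _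
  obtain ⟨n, hn, hgood⟩ := hL31 (dyMass v) ha ⟨C0, hC0⟩
  -- (3.18) and the canonical pressure (3.36)/(3.41)
  have h318' := h318 ν hν v p hf hweak
  obtain ⟨c, hc1, hc2⟩ := h341 ν hν v p hf hD hweak
  -- §3.2–§3.4: the Euler blow-down tangent along the good scales
  obtain ⟨T, hTc⟩ := hcon ν hν v p hf hD hDpos hweak h318' c hc1 hc2 n hn hgood
  -- Prop 3.3 ⟹ Prop 3.4 ⟹ (3.86): the tangent current vanishes
  have hcomp := hP33 ν hν v p hf hDpos T
  have hzero : ZeroRadialFlux (Ioi 1) T.V T.Q := hP34 ν hν v p hf hDpos T hcomp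
  obtain ⟨hint, hlim⟩ := h385 ν hν v p hf hDpos T
  have hcur : tangentCurrent T.V T.P = 0 := h386 T.V T.Q T.P rfl hzero hint
  rw [hcur, neg_zero] at hlim
  -- (3.82) at `R = R_j` and (3.87)
  have hc1' : MemWeakLp (fun x => p x - T.c) ((9 : ℝ≥0∞) / 4) volume := by rw [hTc]; exact hc1
  have hup : ∀ j, cutoffEnergy ν (T.R j) v ≤ current382 (T.R j) v (fun x => p x - T.c) :=
    fun j => (h382 ν hν v p hf hD T.c hc1' (T.R j) (pow_pos two_pos _)).2
  have hlow := h387 ν hν v p hf hD T.R T.R_tendsto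
  -- `νD ≤ 0`, hence `D = 0`: contradiction with `D > 0`
  have hle : ν * (dirichlet v).toReal ≤ 0 := le_of_tendsto_of_tendsto' hlow hlim hup
  have hDreal : (dirichlet v).toReal ≤ 0 := by
    by_contra hcontra
    exact absurd hle (not_le.mpr (mul_pos hν (not_le.mp hcontra)))
  have hD0 : dirichlet v = 0 := by
    have h1 : (dirichlet v).toReal = 0 := le_antisymm hDreal ENNReal.toReal_nonneg
    exact ((ENNReal.toReal_eq_zero_iff _).mp h1).resolve_right hD.ne
  exact absurd hD0 h0

/-! ## TRUE column (records): the elementary closing step `D = 0 ⟹ v ≡ 0` is a theorem -/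

/-- **`Step_D0` holds** (p.26 l.160–161 «Hence ∇v = 0 almost everywhere; smoothness makes v
constant, and the zero far-field condition gives v ≡ 0»), proved exactly along the printed line with
the tree's lemmas of `SereginWangAnnularLiouvilleHolds.lean` (`continuous_frobeniusNormSq_fderiv`,
`eq_zero_of_frobeniusNormSq_eq_zero`) and Mathlib's `is_const_of_fderiv_eq_zero`; the far-field
condition is read through `NeBot (cocompact ℝ³)`. [cite: Wu2026, p.26 l.160–161] -/
theorem step_D0_holds : Step_D0 := by
  intro ν _hν v p hf hD0
  have hU : ContDiff ℝ (⊤ : ℕ∞) v := hf.smooth_v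
  have hcont : Continuous fun x => ENNReal.ofReal (frobeniusNormSq (fderiv ℝ v x)) :=
    ENNReal.continuous_ofReal.comp (SereginWangProof.continuous_frobeniusNormSq_fderiv hU)
  have hae : (fun x => ENNReal.ofReal (frobeniusNormSq (fderiv ℝ v x))) =ᵐ[volume] 0 :=
    (lintegral_eq_zero_iff hcont.measurable).1 hD0
  have hzero : (fun x => ENNReal.ofReal (frobeniusNormSq (fderiv ℝ v x))) = 0 :=
    (hcont.ae_eq_iff_eq volume continuous_const).1 hae
  have hDU : ∀ x, fderiv ℝ v x = 0 := fun x => by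
    have h1 : ENNReal.ofReal (frobeniusNormSq (fderiv ℝ v x)) = 0 := congrFun hzero x
    rw [ENNReal.ofReal_eq_zero] at h1
    exact SereginWangProof.eq_zero_of_frobeniusNormSq_eq_zero _
      (le_antisymm h1 (frobeniusNormSq_nonneg _))
  have hconst : ∀ x, v x = v 0 := fun x =>
    is_const_of_fderiv_eq_zero (hU.differentiable (by simp)) hDU x 0
  have hveq : v = fun _ => v 0 := funext hconst
  have ht : Tendsto (fun _ : E3 => v 0) (cocompact E3) (𝓝 0) := hveq ▸ hf.decay
  have hv0 : v 0 = 0 := tendsto_nhds_unique tendsto_const_nhds ht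
  rw [hveq, hv0]
  rfl

/-- `Step_D0` — `_holds` alias of `step_D0_holds` above under the fact's exact name (appended
2026-08-28, D-0026 bookkeeping: the proof term is the existing theorem of this file; no statement,
definition or attribute is edited; no new named fact; the ledger's debt table listed the fact
unproved). [cite: Wu2026, p.26 l.160–161] -/
theorem _root_.Literature.Claims.NS.Wu2026.Step_D0_holds : Step_D0 :=
  _root_.Literature.Claims.NS.Wu2026.step_D0_holds

/-- The composition with the proved step fed in: thirteen printed steps imply Theorem 1.1. [cite: Wu2026, proof of Thm 1.1, p.26 l.107–161] -/
theorem claim_of_steps' (h21 : Step_L21) (h33 : Step_33) (h38 : Step_38) (hL31 : Step_L31)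
    (h318 : Step_318) (h341 : Step_341) (hcon : Step_construct) (hP33 : Step_P33)
    (hP34 : Step_P34) (h382 : Step_382) (h385 : Step_385) (h386 : Step_386) (h387 : Step_387) :
    ClaimedTheorem :=
  claim_of_steps h21 h33 h38 hL31 h318 h341 hcon hP33 hP34 h382 h385 h386 h387 step_D0_holds

/-- Corollary 1.2 from the steps (via the tree's `Wu2026_cor12_of_thm11`). [cite: Wu2026, Cor 1.2 p.2 l.42–56] -/
theorem claimedCor_of_steps (h21 : Step_L21) (h33 : Step_33) (h38 : Step_38) (hL31 : Step_L31)
    (h318 : Step_318) (h341 : Step_341) (hcon : Step_construct) (hP33 : Step_P33)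
    (hP34 : Step_P34) (h382 : Step_382) (h385 : Step_385) (h386 : Step_386) (h387 : Step_387)
    (hD0 : Step_D0) : ClaimedCor :=
  claimedCor_of_claimedTheorem
    (claim_of_steps h21 h33 h38 hL31 h318 h341 hcon hP33 hP34 h382 h385 h386 h387 hD0)

/-! ## TRUE column (records): Lemma 3.1 (dyadic good-scale selection) is a theorem -/

/-- One finite block of good starting indices (p.8 l.73 – p.9 l.37, (3.11)–(3.15)): for `N ≥ L + 1`
some `n ∈ [N, 2N]` has `a_{n+m} ≤ B_m` for all `0 ≤ m ≤ L`. The printed pigeonhole, with the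
summable choice `B_m = 12·C·2^m` in place of the printed `K₀(m+1)²` (p.8 l.57–72: any `B` with
`Σ_m 3C/B_m < 1` per unit of `N` works; the statement of Lemma 3.1 only asks for finite `B_m`). [cite: Wu2026, Lemma 3.1 proof p.8 l.73 – p.9 l.37] -/
theorem exists_good_block {a : ℕ → ℝ} (ha : ∀ k, 0 ≤ a k) {C : ℝ} (hC : 0 < C)
    (hsum : ∀ N : ℕ, ∑ k ∈ Finset.range (N + 1), a k ≤ C * (N + 1)) (L N : ℕ)
    (hLN : L + 1 ≤ N) :
    ∃ n, N ≤ n ∧ n ≤ 2 * N ∧ ∀ m ≤ L, a (n + m) ≤ 12 * C * 2 ^ m := by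
  classical
  set T : Finset ℕ := Finset.Icc N (2 * N) with hT
  set S : ℕ → Finset ℕ := fun m => T.filter (fun n => 12 * C * 2 ^ m < a (n + m)) with hS
  -- (3.11)–(3.12): each bad set is small, `|S m| ≤ N / (4·2^m)`
  have hcard : ∀ m ≤ L, ((S m).card : ℝ) ≤ N / (4 * 2 ^ m) := by
    intro m _hm
    have h1 : ((S m).card : ℝ) * (12 * C * 2 ^ m) ≤ ∑ n ∈ S m, a (n + m) := by
      have := Finset.card_nsmul_le_sum (S m) (fun n => a (n + m)) (12 * C * 2 ^ m)
        (fun n hn => (Finset.mem_filter.mp hn).2.le)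
      rwa [nsmul_eq_mul] at this
    have h2 : ∑ n ∈ S m, a (n + m) ≤ ∑ r ∈ Finset.range (2 * N + L + 1), a r := by
      have hinj : Set.InjOn (fun n => n + m) (S m : Set ℕ) := fun x _ y _ h =>
        Nat.add_right_cancel h
      rw [← Finset.sum_image hinj]
      apply Finset.sum_le_sum_of_subset_of_nonneg
      · intro r hr
        obtain ⟨n, hn, rfl⟩ := Finset.mem_image.mp hr
        have hnT := Finset.mem_Icc.mp (Finset.mem_filter.mp hn).1
        simp only [Finset.mem_range]
        omega
      · exact fun r _ _ => ha r
    have h3 : ∑ r ∈ Finset.range (2 * N + L + 1), a r ≤ C * ((2 * N + L : ℕ) + 1) :=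
      hsum (2 * N + L)
    have h4 : C * ((2 * N + L : ℕ) + 1) ≤ 3 * C * N := by
      have : (L : ℝ) + 1 ≤ N := by exact_mod_cast hLN
      push_cast
      nlinarith
    have key : ((S m).card : ℝ) * (4 * 2 ^ m) * (3 * C) ≤ (N : ℝ) * (3 * C) := by
      calc ((S m).card : ℝ) * (4 * 2 ^ m) * (3 * C) = ((S m).card : ℝ) * (12 * C * 2 ^ m) := by
            ring
        _ ≤ 3 * C * N := h1.trans (h2.trans (h3.trans h4))
        _ = (N : ℝ) * (3 * C) := by ring
    rw [le_div_iff₀ (by positivity : (0 : ℝ) < 4 * 2 ^ m)]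
    exact le_of_mul_le_mul_right key (by positivity)
  -- (3.13)–(3.14): the union of the bad sets has fewer than `N + 1` elements
  set bad : Finset ℕ := (Finset.range (L + 1)).biUnion S with hbad
  have hbad_card : (bad.card : ℝ) ≤ N / 2 := by
    calc (bad.card : ℝ) ≤ ∑ m ∈ Finset.range (L + 1), ((S m).card : ℝ) := by
          exact_mod_cast Finset.card_biUnion_le
      _ ≤ ∑ m ∈ Finset.range (L + 1), (N : ℝ) / (4 * 2 ^ m) :=
          Finset.sum_le_sum fun m hm =>
            hcard m (Nat.lt_succ_iff.mp (Finset.mem_range.mp hm))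
      _ = (N / 4) * ∑ m ∈ Finset.range (L + 1), (1 / 2 : ℝ) ^ m := by
          rw [Finset.mul_sum]
          refine Finset.sum_congr rfl fun m _ => ?_
          rw [one_div, inv_pow]
          ring
      _ ≤ (N / 4) * 2 := by
          gcongr
          exact sum_geometric_two_le _
      _ = N / 2 := by ring
  -- (3.15): a good starting index exists among the `N + 1` candidates
  have hTcard : T.card = N + 1 := by
    rw [hT, Nat.card_Icc]
    omega
  have hlt : bad.card < T.card := by
    have : (bad.card : ℝ) < (T.card : ℝ) := by
      rw [hTcard]
      push_cast
      linarith [hbad_card, (Nat.cast_nonneg N : (0 : ℝ) ≤ N)]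
    exact_mod_cast this
  obtain ⟨n, hnT, hnbad⟩ := Finset.exists_mem_notMem_of_card_lt_card hlt
  refine ⟨n, (Finset.mem_Icc.mp hnT).1, (Finset.mem_Icc.mp hnT).2, fun m hm => ?_⟩
  by_contra hcon
  exact hnbad (Finset.mem_biUnion.mpr
    ⟨m, Finset.mem_range.mpr (Nat.lt_succ_of_le hm), Finset.mem_filter.mpr ⟨hnT, not_le.mp hcon⟩⟩)

/-- **Lemma 3.1 holds** (p.8 l.54–57; proof p.8 l.58 – p.9 l.45): the printed construction —
successive good blocks chosen farther out, `n₀ = 0`, `n_j ∈ [N_j, 2N_j]` with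
`N_j > max{j, 2n_{j−1}}` good for the offsets `0 ≤ m ≤ j` (p.9 l.38–45) — with the summable bound
`B_m = 12·max{C₀,1}·2^m` (see `exists_good_block`). [cite: Wu2026, Lemma 3.1 p.8–9] -/
theorem step_L31_holds : Step_L31 := by
  intro a ha hC0
  obtain ⟨C0, hC0⟩ := hC0
  set C := max C0 1 with hCdef
  have hC : 0 < C := lt_of_lt_of_le one_pos (le_max_right _ _)
  have hsum : ∀ N : ℕ, ∑ k ∈ Finset.range (N + 1), a k ≤ C * (N + 1) := fun N =>
    (hC0 N).trans (by gcongr; exact le_max_left _ _)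
  -- successive blocks (p.9 l.38–41)
  have block : ∀ j n0 : ℕ, ∃ n, max (j + 2) (2 * n0 + 1) ≤ n ∧
      ∀ m ≤ j + 1, a (n + m) ≤ 12 * C * 2 ^ m := by
    intro j n0
    obtain ⟨n, hNn, -, hgood⟩ :=
      exists_good_block ha hC hsum (j + 1) (max (j + 2) (2 * n0 + 1)) (le_max_left _ _)
    exact ⟨n, hNn, hgood⟩
  choose f hf using block
  let n : ℕ → ℕ := fun j => Nat.rec 0 (fun j nj => f j nj) j
  have hn_succ : ∀ j, n (j + 1) = f j (n j) := fun j => rfl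
  have hn_ge : ∀ j, j ≤ n j := by
    intro j
    induction j with
    | zero => exact Nat.zero_le _
    | succ j _ =>
      rw [hn_succ]
      have := le_of_max_le_left (hf j (n j)).1
      omega
  refine ⟨n, tendsto_atTop_mono hn_ge tendsto_id, fun m => ⟨12 * C * 2 ^ m, fun j hj => ?_⟩⟩
  have h1 : 1 ≤ j := le_of_max_le_left hj
  have hm : m ≤ j := le_of_max_le_right hj
  obtain ⟨j', rfl⟩ : ∃ j', j = j' + 1 := ⟨j - 1, by omega⟩
  rw [hn_succ]
  exact (hf j' (n j')).2 m (by omega)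

/-- **Composition of record after rev 2**: the eleven printed analytic steps imply Theorem 1.1,
with the two elementary steps (`Step_L31` = Lemma 3.1, `Step_D0`) fed by their in-file proofs. [cite: Wu2026, proof of Thm 1.1 p.26 l.107–161] -/
theorem claim_of_steps'' (h21 : Step_L21) (h33 : Step_33) (h38 : Step_38) (h318 : Step_318)
    (h341 : Step_341) (hcon : Step_construct) (hP33 : Step_P33) (hP34 : Step_P34)
    (h382 : Step_382) (h385 : Step_385) (h386 : Step_386) (h387 : Step_387) : ClaimedTheorem :=
  claim_of_steps h21 h33 h38 step_L31_holds h318 h341 hcon hP33 hP34 h382 h385 h386 h387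
    step_D0_holds

end Literature.Claims.NS.Wu2026
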